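import Summits.BirchSwinnertonDyer.Rank1Residual.X10.CoreTheoremAOddPrime
import HarnessLib
import HarnessLib.Audit

/-!
# Euler-primitivity on class X9: «some genuine `Λ`-adic Euler-system class of Kato's `𝐇¹_Γ(T_pE)` is
# not divisible by `p`» — the cell's Euler-system-lens candidate ES-C2, filed as an OPEN obligation
# node (`@[conjecture] def`); nothing asserted

HONEST FRAMING (cell `bsd-f3-mu`, D-0131 (3) FRONTIER TIER, HOME `run/shared/lean/pub/bsd-f3-mu/`).
TYPER's filing of the `-es` lens's generation-1 candidates (2026-08-27): a pure CONJECTURE LEAF — only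
`@[conjecture] def`s (ES-C2, and its graded reading S-es-3 `FineMuLeEulerLossOnClassX9`), no theorem, typed ≠ proved ≠ endorsed.  The statement is VERBATIM the Euler-system
HYPOTHESIS of the kernel theorem `X10.coreTheoremAOddPrime_holds` (the `μ`-transfer core at any odd prime,
`Irr ∧ ¬Surj`; sibling `X10/CoreTheoremAOddPrime.lean`, whose `@[conjecture] def CoreTheoremAOddPrime`
carries it as an antecedent), asserted CLASS-WIDE on X9.  Kernel edges live in the sibling
`EulerPrimitiveEdges.lean`: (b1) item 19630 `AnalyticMuZeroOnClassX9` ∧ F1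
(`Kato2004.exists_divisibilityInputs_fineQuotient_zeta`) ⟹ ES-C2 — so its OPEN content sits on the X9
pairs with `μ(L_p) ≥ 1` only (none on the census); (b2) ES-C2 ⟹ the core conclusion on X9 (kernel);
(b3) ES-C2 ∧ F1 ⟹ `μ(X₀(E/ℚ_∞)) = 0` for every dual fine Selmer datum on X9 (Coates–Sujatha Conj. A,
`μ`-part, on X9); (b4) ES-C2 ∧ F1 ∧ S-W⁺ (`Rank1Residual.MuDefectLeFineMuAt`: `k ≤ μ(X₀)`, Kato §17.13 bookkeeping;
it subsumes `-es`'s S-es-2 «`μ(X₀) = 0 ⟹ k ≤ 0`», the `μ`-part of «Conj. A ⟹ Kato divisibility») ∧ BCS (a)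
⟹ the cell node `KatoDivisibilityOnClassX9` — the Euler-system road to the node.

## Provenance (cell record)

* MEMO-es.md gen 1 / STATUS 15:03:10Z (planner `-es` g1; `HOME/es/Sketch2.lean` sha16 98494ff64eca5b0a,
  rc 0, 0 sorry, std axioms; BC7 probes `HOME/es/Sketch2Probe.lean`: ES-C2 CLEAN, S-es-2 CLEAN
  (`bc7_verdicts2.txt`)): **ES-C2 `EulerPrimitiveOnClassX9`** + support S-es-2 + bridges b1–b4′.
  Planner's correction (15:03Z): per pair `δ = 0` (zeta class `p`-primitive) ⟹ `μ(X₀) = 0` and `k ≤ 0`;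
  «`δ = 0 ⟺ μ_an = 0`» is NOT claimed (only ⟸, mod F1).
* Refuter verdicts: REF1-AUDIT.md §3.2 / REF2-LITMAP.md §3 gen-2 rows (posted after this filing's
  drafting; CANDIDATES.md §1 row 6 carries the codes of record).
* BC5 witness: every certified row of the census of record (`k6fin_unitcoeff_cert.tsv` sha16
  dde28b2c4045f536: 790/790 two-engine `μ_an = 0`) satisfies ES-C2 modulo F1 by (b1); open regime = rows
  with `μ_an ≥ 1`: 0/790.  Cheapest falsifier: none from the `μ`-table (as for the node: a certified row
  with `sel_p_rank > lambda_an` would refute the CONSEQUENCE `KatoDivisibilityOnClassX9` given F1 ∧ S-es-2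
  ∧ BCS (a)).
* Why a separate node (planner): it is the exact INPUT type of the kernel core theorem (Euler-system
  currency, no `L`-function in the statement), implied by 19630, and it routes to the cell node through
  the fine Selmer group (Conj. A `μ`-part) rather than through `μ(Sel)`.

References: [Kato2004Asterisque] Thm. 12.5, 12.6 (p. 222), Thm. 13.6, §17.13 (pp. 279–280);
[CoatesSujatha2005] Conj. A; [Wuthrich2007JAG] §8; HOME MEMO-es.md, es/Sketch2.lean, CANDIDATES.md §1.
-/

-- the summit and its single problem are both named `BirchSwinnertonDyer` (registry layout D-0017)
set_option linter.dupNamespace false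

noncomputable section

open scoped Classical

open WeierstrassCurve Field Literature.NumberTheory.EllipticCurves
  Literature.NumberTheory.EllipticCurves.Kato2004
  Literature.NumberTheory.EllipticCurves.Kato2004.EulerSystemValues
  Summit.BirchSwinnertonDyer.BirchSwinnertonDyer.Rank1Residual

namespace Summit.BirchSwinnertonDyer.Rank1Residual.SmallImageMu

/-- **ES-C2 — Euler-primitivity on class X9 (OPEN on the pairs with `μ(L_p) ≥ 1`; cell candidate;
nothing asserted).**  At every X9 pair `(E, p)` (non-CM, `p ≥ 5` good ordinary, `E[p]` irreducible, `ρ̄`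
not surjective), for the cyclotomic `(κ, γ)` and any model `I` of Kato's `𝐇¹_Γ(T_pE)` (`IwasawaH1Data`):
some GENUINE `Λ`-adic Euler-system class `s ∈ 𝐇¹` (`IsEulerSystemClass`) is not divisible by `p`
(`s ∉ p·𝐇¹`, `p = augIdealP`).  Verbatim the hypothesis of `X10.CoreTheoremAOddPrime`, class-wide on X9;
verbatim the audited `HOME/es/Sketch2.lean` text.
[cite: Kato2004Asterisque, Thm. 12.5 and 12.6 (p. 222), Thm. 13.6 — shape only; OPEN as a class-wide statement on X9] -/
@[conjecture] def EulerPrimitiveOnClassX9 : Prop :=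
  ∀ (W : WeierstrassCurve ℚ) [W.IsElliptic] [W.IsGloballyMinimal] (p : ℕ) [Fact p.Prime]
    [ContinuousSMul ℤ_[p] (W.tateModule p)] [Module.Free ℤ_[p] (W.tateModule p)]
    [Module.Finite ℤ_[p] (W.tateModule p)]
    (κ : ZpExtension ℚ p) (γ : absoluteGaloisGroup ℚ) (I : IwasawaH1Data W p κ γ),
    ClassX9 W p → κ.IsCyclotomic → κ.IsTopGenerator γ → IsCyclotomicVariable p γ →
    ∃ s : I.H, IsEulerSystemClass W p κ γ I s ∧
      s ∉ IwasawaAlgebra.augIdealP p • (⊤ : Submodule (IwasawaAlgebra p) I.H)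

/-- **S-es-3 — the Euler-currency READING of the crux, graded by the Euler loss `δ` (OPEN for `n ≥ 1`;
nothing asserted).**  At every X9 pair and every `n : ℕ`: if some genuine `Λ`-adic Euler-system class
`s ∈ 𝐇¹` is not divisible by `p^{n+1}` (`s ∉ p^{n+1}𝐇¹`, i.e. Euler loss `δ(s) ≤ n`), then
`μ(X₀(E/ℚ_∞)) ≤ n` for every dual fine Selmer datum.  The case `n = 0` IS the kernel core theorem
(`X10.coreTheoremAOddPrime_holds` + the `μ`-count of `EulerPrimitiveEdges.lean` (b3)); the cases `n ≥ 1`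
are the `(p)`-part of Kato's Thm. 13.4 bound `length_𝔭(X₀) ≤ length_𝔭(𝐇¹/Z)` — printed only for
`𝔭 ∌ p` without (im), and WITH a Kolyvagin `τ` as Rubin's Thm. 2.3.3, without `τ` only up to an
unspecified `p^t` (Rubin Thm. 2.3.4; both quoted by Wuthrich, MRL 13 p. 715): S-es-3 is exactly
«`t = 0` at `𝔭 = (p)`», the `μ`-form of the `τ`-wall (REF2-LITMAP M17).  By the F1 identity
`μ(X₀) = k + δ + c` it gives the crux `k ≤ 0` at the pair: «dividing the Euler system by `p^δ` costs
exactly `δ` in `μ`».  Verbatim `HOME/es/Sketch2.lean` (v2, sha16 3730091928b70604); ref2 g2: OPEN on X9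
for `n ≥ 1`, in print with `τ`.
[cite: Kato2004Asterisque, Thm. 13.4 (p. 226) and §13.8 — the bound at primes `𝔭 ∌ p`; OPEN at `𝔭 = (p)` on X9]
[cite: Wuthrich2006, p. 715 (quoting Rubin's Thms. 2.3.3–2.3.4: the `p^t` loss without `τ`)] -/
@[conjecture] def FineMuLeEulerLossOnClassX9 : Prop :=
  ∀ (W : WeierstrassCurve ℚ) [W.IsElliptic] [W.IsGloballyMinimal] (p : ℕ) [Fact p.Prime]
    [ContinuousSMul ℤ_[p] (W.tateModule p)] [Module.Free ℤ_[p] (W.tateModule p)]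
    [Module.Finite ℤ_[p] (W.tateModule p)]
    (κ : ZpExtension ℚ p) (γ : absoluteGaloisGroup ℚ) (I : IwasawaH1Data W p κ γ) (n : ℕ),
    ClassX9 W p → κ.IsCyclotomic → κ.IsTopGenerator γ → IsCyclotomicVariable p γ →
    (∃ s : I.H, IsEulerSystemClass W p κ γ I s ∧
      s ∉ (IwasawaAlgebra.augIdealP p ^ (n + 1)) • (⊤ : Submodule (IwasawaAlgebra p) I.H)) →
    ∀ Y : W.FineSelmerDualData κ γ, muInvariant p Y.X ≤ n

end Summit.BirchSwinnertonDyer.Rank1Residual.SmallImageMu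

end
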